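import Summits.BirchSwinnertonDyer.Rank1Residual.Additive.X4TamDefectMazurPrinciple
import Summits.BirchSwinnertonDyer.Rank1Residual.Additive.PlusSymbolIntegrality
import Summits.BirchSwinnertonDyer.Rank1Residual.X4.LevelLoweringOfOldOnCycles
import Summits.BirchSwinnertonDyer.Rank1Residual.X4.PlusFunctionalModP
import Literature.NumberTheory.EllipticCurves.HidaFamilyMembersProofs
import Literature.NumberTheory.EllipticCurves.LFunctionPrimeCoeff
import Literature.NumberTheory.EllipticCurves.PAdicBSDSplitMultiplicativeProofs
import HarnessLib

/-!
# TAM-DEFECT₂ from MAZUR'S PRINCIPLE ON CYCLES: the level-lowering certificate DERIVED from the inclusion `E'[p] ⊆ B_ℓ` + Ihara BY NAME (cell `b2b-bsdres`, seat additive-p4, line V45)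

HONEST FRAMING (verbatim, cell `b2b-bsdres`): the goal of the cell is to DELETE the COMBINATION-SHAPED
residual classes for ALL analytic-rank `≤ 1` curves over `ℚ` — "full BSD formula for every rank `≤ 1`
curve in class `C`" assembled STRICTLY from published theorems — so that the rank-`≤ 1` remainder
becomes exactly the CONSTRUCTION-SHAPED classes, which are TYPED (missing-input Props), NOT attempted;
this is not "finishing BSD". This file: a research-route file of the CLASS-CLOSURE lane (class
N10/N11 TAM-DEFECT₂ residue, Mazur-principle sub-class): ONE typed target (`@[conjecture] def`, a
`Prop`-valued definition asserting nothing), the KERNEL theorem that turns it into gen 20's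
certificate, and END theorems. Nothing booked; X4 stays CONSTRUCTION-SHAPED; no Literature fact.

## What changes relative to gen 24 (`Additive/X4TamDefectMazurPrinciple`)

Gen 24's target `MazurPrincipleLevelLowersAt W p f ℓ` asserted the WHOLE passage "row data ⟹ the
mod-`p` plus symbol of `f` level-lowers at `ℓ`" (`PlusSymbolLevelLowersAt`), whose provenance is:
(i) MAZUR'S PRINCIPLE transplanted to the `ℓ`-new quotient (`E'[p] ⊆ B_ℓ`), then (ii) Ihara's lemma
+ (iii) the Manin–Drinfeld / modular-symbol dictionary. V45 puts (ii)+(iii) IN THE KERNEL: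

* the NEW, SHARPER target `MazurPrincipleOldOnCycles W p ℓ f` asserts ONLY (i), in cohomological
  form ON CYCLES: the reduced plus symbol of `f` restricted to `H₁(X₀(Mℓ), ℤ)` is `ℓ`-OLD —
  `[γ∞]⁺_f mod p = Λ₁(α_*{∞, γ∞}) + Λ₂(β_*{∞, γ∞})` for two additive `𝔽_p`-valued `Λ₁, Λ₂` on
  `H₁(X₀(M), ℤ)` (this IS `E'[p] ⊆ B_ℓ` read on `H¹(X₀(Mℓ), 𝔽_p) = Hom(H₁, 𝔽_p)`: the pull-back
  `(α_*, β_*)^*` of `Hom(H₁(X₀(M))², 𝔽_p)` is the `ℓ`-old part);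
* `plusSymbolLevelLowersAt_of_oldOnCycles` PROVES gen 20's certificate from it + `ribet1984_iharaLemma`
  (BY NAME) + ONE numeral prime `q₀ ≡ 1 (mod Mℓ)` with `a_{q₀}(E) ≢ q₀ + 1 (mod p)` (exists by
  Chebotarev whenever `ρ̄_{E,p}` is onto and `p ∣ N`; a row numeral), through the V45 chain: the
  level-`M` character dichotomy (`X4/LevelLoweringCharacter`), the Fitting projection along Ihara's
  element (`X4/OldEigenPairOfIhara`), the forced `ℓ`-stabilised shape (`X4/OldShapeOfIhara`), and
  Manin's closing of the path (`X4/LevelLoweringOfOldOnCycles`) applied to the mod-`p` plus functional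
  of `f` (`X4/PlusFunctionalModP`);
* `mazurPrincipleLevelLowersAt_of_oldOnCycles`: gen 24's target FOLLOWS from the new one;
* ENDs `X4.bsdp_of_oldOnCycles_…`: the TAM-DEFECT₂ rows with a Mazur-principle prime close at `p ≥ 5`
  (Kim 2026 (6), Cassels–Tate, GZK, modularity — PUBLISHED) and at `p ≥ 3` modulo the announced
  Kim 2025 clause, from the NEW target + Ihara by name + numerals.

NOT in print as stated (hence a TARGET): the inclusion itself — Ribet 1990 §6 / Ribet–Stein 2001
Thm. 3.14 prove it for `J₀(N)` ("Mazur's principle"); the transfer to the `ℓ`-new quotient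
`J₀(N)/B_ℓ` (purely toric at `ℓ`; Frobenius `= ℓ T_ℓ = ±ℓ` scalar on the torus, RS Lemma 3.17) and
the irreducibility step are ours (memo `V43-MAZUR-PRINCIPLE.md` §1–§2; print review n1011-lit
2026-08-22 "inputs STATEMENT-EXACT; flag `proof-variant (new quotient)`"). Census (unchanged, V43):
`p ≥ 5` TAM₂ 172/172 rows carry such an `ℓ` (corner 133/133); `p = 3`: 1 743/1 888.

## References

* K. Ribet, W. Stein, *Lectures on Serre's conjectures* (2001), Thm. 3.14, Lemma 3.17. [cite: RibetStein2001, Thm. 3.14 and Lemma 3.17]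
* K. Ribet, Invent. Math. 100 (1990), §6, Thm. 3.12. [cite: Ribet1990, §6 and Thm. 3.12]
* K. A. Ribet, Proc. ICM 1983 (1984), Thm. 4.1. [cite: Ribet1984ICM, Thm. 4.1]
* Ju. I. Manin, Izv. Akad. Nauk SSSR 36 (1972), Thm. 3.3, Cor. 3.6. [cite: Manin1972, Thm. 3.3 (20) and Thm. 3.5 (22)]
* C.-H. Kim, Amer. J. Math. 148 (2026), Thm. 1.9 (6), Conj. 1.10. [cite: Kim2022StructureSelmer, Thm. 1.9 (6) and Conj. 1.10 (PDF p. 8)]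
* J. H. Silverman, *AEC* (2009), §C.16 (`a_ℓ = 1` at split multiplicative `ℓ`), Exercise 8.19. [cite: SilvermanAEC2009, §C.16 (definition of L_v(T)), PDF p. 390]
-/

noncomputable section

open scoped MatrixGroups ModularForm Classical

open CongruenceSubgroup Finset

open Literature.NumberTheory.EllipticCurves Literature.NumberTheory.EllipticCurves.ModularForms

namespace Summit.BirchSwinnertonDyer.Rank1Residual.LevelLowering

/-! ### §1 The typed target: Mazur's principle as an `ℓ`-old decomposition on cycles -/

section Target

variable (W : WeierstrassCurve ℚ) [W.IsGloballyMinimal] (p : ℕ) [Fact p.Prime]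
  {M : ℕ} [NeZero M] (ℓ : ℕ) [Fact ℓ.Prime] (f : CuspForm (Gamma0 (M * ℓ)) 2)

/-- **MAZUR'S PRINCIPLE ON CYCLES (typed target; V45).** For `W/ℚ` globally minimal with newform `f`
at its conductor `N = Mℓ`, an odd prime `p` with `W[p]` irreducible, and a prime `ℓ ≠ p`, `ℓ ∤ M`
(so `ℓ ∥ N`), of SPLIT multiplicative reduction with `p ∣ c_ℓ(W)` such that `ℓ ≢ 1 (mod p)` or
`#W(ℚ_ℓ)[p] ≠ p²` (`ρ̄_{W,p}(Frob_ℓ)` non-scalar): the mod-`p` plus symbol of `f` is `ℓ`-OLD ON CYCLES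
— there are additive `Λ₁, Λ₂ : H₁(X₀(M), ℤ) → 𝔽_p` with
`[γ∞]⁺_f mod p = Λ₁(α_*{∞, γ∞}) + Λ₂(β_*{∞, γ∞})` for every `γ ∈ Γ₀(Mℓ)` with a finite cusp `γ∞`
(`α_* = (degeneracyMap0 M (Mℓ) 1 2)^∨`, `β_* = (degeneracyMap0 M (Mℓ) ℓ 2)^∨` on the tree's period
homology). This is the inclusion `E'[p] ⊆ B_ℓ` of the optimal curve's `p`-torsion in the `ℓ`-old
subvariety of `J₀(N)`, read on `Hom(H₁(X₀(N), ℤ), 𝔽_p)`. STATUS: NOT in print as stated — it is the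
printed proof of Mazur's principle (Ribet 1990 §6 = Ribet–Stein 2001 Thm. 3.14, Lemma 3.17; Φ
Eisenstein by Ribet 1990 Thm. 3.12) transplanted to the `ℓ`-new quotient of `J₀(N)` (purely-toric
transfer + irreducibility steps ours). The Ihara / Manin–Drinfeld half of gen 24's target is NO
LONGER part of the target: it is PROVED below. A TARGET; nothing asserted.
UPDATE (V46, GEN 27): EQUIVALENT, modulo `ribet1984_iharaLemma` and one numeral prime `q₀ ≡ 1
(mod Mℓ)` with `a_{q₀} ≢ q₀ + 1 (mod p)`, to the SMALLER target `MazurPrincipleNewVanishing W p ℓ f`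
of `Additive/X4TamDefectMazurPrincipleNewVanishing` ("`[γ∞]⁺_f ≡ 0 (mod p)` on every level-`Mℓ`
cycle killed by both `α_*` and `β_*`" — no level-`M` object): the additivity of `Λ₁, Λ₂` demanded
here is the extension across the Eisenstein cokernel of `(α_*, β_*)`, a kernel theorem
(`X4/OldPairOfNewVanishing.exists_oldPair_of_apply_eq_zero_of_ribet1984_iharaLemma`); see
`mazurPrincipleOldOnCycles_of_newVanishing` / `mazurPrincipleNewVanishing_of_oldOnCycles`. New
consumers should key to the V46 target; this one is kept for its ENDs.
[cite: RibetStein2001, Thm. 3.14 and Lemma 3.17] [cite: Ribet1990, §6 and Thm. 3.12] -/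
@[conjecture] def MazurPrincipleOldOnCycles : Prop :=
  IsNewformOf W f → W.conductorNorm ℤ = M * ℓ → p ≠ 2 → W.HasIrreducibleModPGaloisRep p →
    ℓ ≠ p → ¬ ℓ ∣ M → W.HasSplitMultiplicativeReductionAtPrime ℓ →
    p ∣ (W.baseChange ℚ_[ℓ]).localTamagawaNumber ℤ_[ℓ] →
    (¬ ℓ ≡ 1 [MOD p] ∨
      Nat.card {P : (W.baseChange ℚ_[ℓ]).toAffine.Point // p • P = 0} ≠ p ^ 2) →
    ∃ Λ₁ Λ₂ : Module.Dual ℂ (CuspForm (Gamma0 M) 2) → ZMod p,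
      (∀ x ∈ periodHomology M, ∀ y ∈ periodHomology M, Λ₁ (x + y) = Λ₁ x + Λ₁ y) ∧
      (∀ x ∈ periodHomology M, ∀ y ∈ periodHomology M, Λ₂ (x + y) = Λ₂ x + Λ₂ y) ∧
      ∀ γ : Gamma0 (M * ℓ), (γ : SL(2, ℤ)) 1 0 ≠ 0 →
        ((ratPlusSymbol f ((((γ : SL(2, ℤ)) 0 0 : ℤ) : ℚ) / (((γ : SL(2, ℤ)) 1 0 : ℤ) : ℚ)) : ℚ) :
            ZMod p) =
          Λ₁ ((degeneracyMap0 M (M * ℓ) 1 2).dualMap (periodFunctional (M * ℓ) γ)) +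
            Λ₂ ((degeneracyMap0 M (M * ℓ) ℓ 2).dualMap (periodFunctional (M * ℓ) γ))

end Target

/-! ### §2 The kernel theorem: the certificate from the `ℓ`-old decomposition on cycles -/

section Bridge

variable {W : WeierstrassCurve ℚ} [W.IsElliptic] [W.IsGloballyMinimal] {p : ℕ} [hp : Fact p.Prime]
  {M : ℕ} [NeZero M] {ℓ : ℕ} [hℓ : Fact ℓ.Prime] {f : CuspForm (Gamma0 (M * ℓ)) 2}

/-- **THE LEVEL-LOWERING CERTIFICATE FROM THE `ℓ`-OLD DECOMPOSITION ON CYCLES — no multiplicity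
one, Ihara BY NAME.** `W/ℚ` globally minimal with newform `f` at conductor `Mℓ`, `p` odd with `W[p]`
irreducible (so every `[r]⁺_f` is `p`-integral, `Additive/PlusSymbolIntegrality`), `ℓ ∤ M` split
multiplicative (`a_ℓ = 1`); ONE numeral prime `q₀ ≡ 1 (mod Mℓ)` with `a_{q₀}(W) ≢ q₀ + 1 (mod p)`;
Ihara's lemma `ribet1984_iharaLemma`; and additive `Λ₁, Λ₂ : H₁(X₀(M), ℤ) → 𝔽_p` carrying
`[·]⁺_f mod p` on the cycles of level `Mℓ` ⟹ `PlusSymbolLevelLowersAt W p f ℓ` (a `1`-periodic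
`μ : ℚ → 𝔽_p`, Hecke-eigen at the Kolyvagin primes, with `[r]⁺_f ≡ μ(r) − μ(ℓ r)` for ALL `r`). The
V45 chain: `exists_plusFunctional` + `exists_sub_mul_of_oldOnCycles_of_ribet1984_iharaLemma`; the
Kolyvagin primes are good, where `a_q(W) = a_q(f)` (`LFunction_apply_prime_eq_frobeniusTrace`).
[cite: Ribet1984ICM, Thm. 4.1] [cite: Manin1972, Thm. 3.3 (20) and Thm. 3.5 (22)]
[cite: Kim2022StructureSelmer, §1.2.2 and §1.4.3 (PDF pp. 5, 7)] -/
theorem plusSymbolLevelLowersAt_of_oldOnCycles (hI : ribet1984_iharaLemma) (hf : IsNewformOf W f)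
    (hN : W.conductorNorm ℤ = M * ℓ) (hp2 : p ≠ 2) (hirr : W.HasIrreducibleModPGaloisRep p)
    (hℓM : ¬ ℓ ∣ M) (hsplit : W.HasSplitMultiplicativeReductionAtPrime ℓ)
    {q₀ : ℕ} (hq₀ : q₀.Prime) (hq₀1 : q₀ ≡ 1 [MOD M * ℓ])
    (haq₀ : ((W.LFunction q₀ : ℤ) : ZMod p) ≠ q₀ + 1)
    (hOC : ∃ Λ₁ Λ₂ : Module.Dual ℂ (CuspForm (Gamma0 M) 2) → ZMod p,
      (∀ x ∈ periodHomology M, ∀ y ∈ periodHomology M, Λ₁ (x + y) = Λ₁ x + Λ₁ y) ∧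
      (∀ x ∈ periodHomology M, ∀ y ∈ periodHomology M, Λ₂ (x + y) = Λ₂ x + Λ₂ y) ∧
      ∀ γ : Gamma0 (M * ℓ), (γ : SL(2, ℤ)) 1 0 ≠ 0 →
        ((ratPlusSymbol f ((((γ : SL(2, ℤ)) 0 0 : ℤ) : ℚ) / (((γ : SL(2, ℤ)) 1 0 : ℤ) : ℚ)) : ℚ) :
            ZMod p) =
          Λ₁ ((degeneracyMap0 M (M * ℓ) 1 2).dualMap (periodFunctional (M * ℓ) γ)) +
            Λ₂ ((degeneracyMap0 M (M * ℓ) ℓ 2).dualMap (periodFunctional (M * ℓ) γ))) :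
    PlusSymbolLevelLowersAt W p f ℓ := by
  classical
  -- newform data: rational coefficients `θ(q) = a_q(W)`, `p`-integral plus symbols
  have hf0 : IsNewform0 f := hf.1
  have hQ : coeffField f = ⊥ := IsNewformOf.coeffField_eq_bot hf
  have hθ : ∀ q : ℕ, q.Prime → (((fun n : ℕ ↦ (W.LFunction n : ℤ)) q : ℤ) : ℂ) = cuspCoeff f q :=
    fun q _ ↦ (hf.2 q).symm
  have hint : ∀ r : ℚ, ¬ p ∣ (ratPlusSymbol f r).den := fun r ↦
    not_dvd_den_of_norm_ratCast_le_one (Additive.norm_ratPlusSymbol_le_one_of_irreducible hp2 hf hirr r)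
  -- the symbol functionals at the two levels
  have hσ := inftyFunctional_cuspMatrix_apply (M * ℓ)
  have hσ' := inftyFunctional_cuspMatrix_apply M
  -- the mod-`p` plus functional `Ψ` of `f`
  obtain ⟨P, Ψ, hσP, hHP, hTP, hΨadd, hΨσ, hΨT⟩ :=
    exists_plusFunctional (p := p) f hf0 hQ hint (fun n : ℕ ↦ (W.LFunction n : ℤ)) hθ
      (fun r ↦ (inftyFunctional (cuspMatrix r) : Module.Dual ℂ (CuspForm (Gamma0 (M * ℓ)) 2))) hσ
  -- (★★) on cycles, as an identity for `Ψ` on `H₁(X₀(Mℓ), ℤ)`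
  obtain ⟨Λ₁, Λ₂, hadd₁, hadd₂, hcyc⟩ := hOC
  have hold : ∀ z ∈ periodHomology (M * ℓ),
      Ψ z = Λ₁ ((degeneracyMap0 M (M * ℓ) 1 2).dualMap z) +
        Λ₂ ((degeneracyMap0 M (M * ℓ) ℓ 2).dualMap z) := by
    intro z hz
    have hz' : z ∈ (periodHomology (M * ℓ) : Set (Module.Dual ℂ (CuspForm (Gamma0 (M * ℓ)) 2))) := hz
    rw [coe_periodHomology_eq_range] at hz'
    obtain ⟨γ, rfl⟩ := hz'
    by_cases hc : (γ : SL(2, ℤ)) 1 0 = 0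
    · have h0 : Ψ 0 = 0 := by
        have h := hΨadd 0 P.zero_mem 0 P.zero_mem
        rw [add_zero] at h
        linear_combination -h
      rw [periodFunctional_eq_zero_of_apply_eq_zero γ hc, map_zero, map_zero,
        apply_zero_of_additive Λ₁ hadd₁, apply_zero_of_additive Λ₂ hadd₂, add_zero, h0]
    · have e : periodFunctional (M * ℓ) γ =
          (inftyFunctional (cuspMatrix ((((γ : SL(2, ℤ)) 0 0 : ℤ) : ℚ) / (((γ : SL(2, ℤ)) 1 0 : ℤ) : ℚ))) :
            Module.Dual ℂ (CuspForm (Gamma0 (M * ℓ)) 2)) := by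
        ext h
        rw [periodFunctional_apply, cuspSymbol, if_neg hc, hσ]
      have h := hcyc γ hc
      rw [← hΨσ, ← e] at h
      exact h
  -- `a_ℓ(W) = 1` at the split multiplicative prime
  have haℓ : (W.LFunction ℓ : ℤ) = 1 := by
    have h := (hf.cuspCoeff_eq_one_and_sq_of_split hsplit).1
    rw [hf.2 ℓ] at h
    exact_mod_cast h
  -- the V45 chain
  obtain ⟨μ, hper, hH, hid⟩ := exists_sub_mul_of_oldOnCycles_of_ribet1984_iharaLemma hI hℓM hp2
    (fun n : ℕ ↦ (W.LFunction n : ℤ)) (by rw [haℓ, Int.cast_one, one_pow])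
    (fun r ↦ (inftyFunctional (cuspMatrix r) : Module.Dual ℂ (CuspForm (Gamma0 (M * ℓ)) 2))) hσ
    (fun r ↦ (inftyFunctional (cuspMatrix r) : Module.Dual ℂ (CuspForm (Gamma0 M) 2))) hσ'
    P Ψ (fun r ↦ ((ratPlusSymbol f r : ℚ) : ZMod p)) hσP hHP hTP hΨadd hΨσ hΨT Λ₁ Λ₂ hadd₁ hadd₂ hold
    hq₀ hq₀1 haq₀
  refine ⟨μ, hper, fun q hq ↦ ?_, fun r ↦ ?_⟩
  · -- Kolyvagin primes are good: `a_q(W) = a_q(f)`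
    haveI : Fact q.Prime := ⟨hq.prime⟩
    have hqN : ¬ q ∣ W.conductorNorm ℤ := hq.not_dvd_conductorNorm
    have hgood : W.HasGoodReductionAtPrime q := hasGoodReductionAtPrime_of_not_dvd_conductorNorm W hqN
    have h := hH q hq.prime (by rwa [hN] at hqN)
    rwa [W.LFunction_apply_prime_eq_frobeniusTrace q hgood] at h
  · rw [hid r, haℓ, Int.cast_one, one_mul]

/-- **Gen 24's target FOLLOWS from the V45 target** (+ Ihara BY NAME + the numeral `q₀`): the
Ihara / Manin–Drinfeld dictionary half of `MazurPrincipleLevelLowersAt` is a kernel theorem.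
[cite: RibetStein2001, Thm. 3.14 and Lemma 3.17] [cite: Ribet1984ICM, Thm. 4.1] -/
theorem mazurPrincipleLevelLowersAt_of_oldOnCycles (hI : ribet1984_iharaLemma)
    {q₀ : ℕ} (hq₀ : q₀.Prime) (hq₀1 : q₀ ≡ 1 [MOD M * ℓ])
    (haq₀ : ((W.LFunction q₀ : ℤ) : ZMod p) ≠ q₀ + 1)
    (hOC : MazurPrincipleOldOnCycles W p ℓ f) : MazurPrincipleLevelLowersAt W p f ℓ := by
  intro hf hN hp2 hirr hℓp _ hℓ2 hsplit hcℓ hns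
  have hℓM : ¬ ℓ ∣ M := fun h ↦ hℓ2 (by rw [pow_two]; exact Nat.mul_dvd_mul_right h ℓ)
  exact plusSymbolLevelLowersAt_of_oldOnCycles hI hf hN hp2 hirr hℓM hsplit hq₀ hq₀1 haq₀
    (hOC hf hN hp2 hirr hℓp hℓM hsplit hcℓ hns)

end Bridge

end Summit.BirchSwinnertonDyer.Rank1Residual.LevelLowering

/-! ### §3 END: the TAM-DEFECT₂ rows with a Mazur-principle prime close modulo the NEW target -/

namespace Summit.BirchSwinnertonDyer.Rank1Residual.X4

open Complex WeierstrassCurve Literature.NumberTheory.EllipticCurves.Rank1Residual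
  Literature.NumberTheory.EllipticCurves.Rank1Residual.Typed
  Summit.BirchSwinnertonDyer.Rank1Residual.LevelLowering

variable (W : WeierstrassCurve ℚ) [W.IsElliptic] [W.IsGloballyMinimal] (p : ℕ) [Fact p.Prime]

/-- **TAM-DEFECT₂ CLOSURE at `p ≥ 5` FROM MAZUR'S PRINCIPLE ON CYCLES** (MP sub-class; corner
included). `W/ℚ` globally minimal of analytic rank `0`, `p ≥ 5`, `ρ̄_{E,p}` onto, a conductor-level
datum `D` at level `Mℓ = N` with `p ∤ c_D` and the period transfer, `#Ш_an` a `p`-unit,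
`ord_p ∏ c ≤ 2`, a split multiplicative `ℓ ∤ M`, `ℓ ≠ p`, with `p ∣ c_ℓ` and
(`ℓ ≢ 1 (mod p)` ∨ `#E(ℚ_ℓ)[p] ≠ p²`), a numeral prime `q₀ ≡ 1 (mod Mℓ)` with
`a_{q₀} ≢ q₀ + 1 (mod p)`: IF the typed target `MazurPrincipleOldOnCycles W p ℓ D.f` holds THEN
**`BSD(E,p)`** — from Ihara's lemma `ribet1984_iharaLemma` (BY NAME), Kim 2026 Thm. 1.8 (6),
Cassels–Tate, GZK, modularity (PUBLISHED) and the tree's V45 chain. Nothing booked.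
[cite: Kim2022StructureSelmer, Thm. 1.9 (6) and Conj. 1.10 (PDF p. 8)] [cite: RibetStein2001, Thm. 3.14]
[cite: Ribet1984ICM, Thm. 4.1] [cite: SilvermanAEC2009, Thm. X.4.14] -/
theorem bsdp_of_oldOnCycles_of_tamagawa_le_two_of_shaAn_unit_of_five_le
    (hI : ribet1984_iharaLemma)
    (hKimk : Kim2026.rankZero_le_padicValNat_sha_of_kuriharaNumber_ne_zero)
    (hE67c : Kim2026.rankZero_padicValNat_sha_add_le_of_forall_pow_dvd_kuriharaNumber_cyclicLevel)
    (hCT : exists_casselsTate_pairing (K := ℚ))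
    (hGZK : rank_eq_analyticRank_of_analyticRank_le_one) (hmod : hasEntireLFunction_rat)
    (hp : 5 ≤ p) (hr : W.analyticRank = 0) (hsurj : W.HasSurjectiveModNGaloisRep p)
    {M : ℕ} [NeZero M] {ℓ : ℕ} [Fact ℓ.Prime] [NeZero (M * ℓ)]
    (D : ModularParametrizationData W (M * ℓ)) (hN : W.conductorNorm ℤ = M * ℓ)
    (hc : ¬ (p : ℤ) ∣ D.maninConstant)
    (hper : ∃ u : ℚ, ‖(u : ℚ_[p])‖ = 1 ∧ W.realPeriodRat = u * plusPeriod D.f)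
    {q' : ℚ} (hq' : shaAn W = (q' : ℂ)) (hv : padicValRat p q' = 0)
    (hc2 : padicValNat p W.tamagawaProduct ≤ 2)
    (hℓp : ℓ ≠ p) (hℓM : ¬ ℓ ∣ M) (hsplit : W.HasSplitMultiplicativeReductionAtPrime ℓ)
    (hcℓ : p ∣ (W.baseChange ℚ_[ℓ]).localTamagawaNumber ℤ_[ℓ])
    (hns : ¬ ℓ ≡ 1 [MOD p] ∨
      Nat.card {P : (W.baseChange ℚ_[ℓ]).toAffine.Point // p • P = 0} ≠ p ^ 2)
    {q₀ : ℕ} (hq₀ : q₀.Prime) (hq₀1 : q₀ ≡ 1 [MOD M * ℓ])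
    (haq₀ : ((W.LFunction q₀ : ℤ) : ZMod p) ≠ q₀ + 1)
    (hOC : MazurPrincipleOldOnCycles W p ℓ D.f) : BSDp W p :=
  bsdp_of_mazurPrinciple_of_tamagawa_le_two_of_shaAn_unit_of_five_le W p hKimk hE67c hCT hGZK hmod hp
    hr hsurj D hN hc hper hq' hv hc2 hℓp (dvd_mul_left ℓ M)
    (fun h ↦ hℓM (Nat.dvd_of_mul_dvd_mul_right (Fact.out : ℓ.Prime).pos (by rwa [pow_two] at h)))
    hsplit hcℓ hns (mazurPrincipleLevelLowersAt_of_oldOnCycles hI hq₀ hq₀1 haq₀ hOC)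

/-- **The `p ≥ 3` tower twin from Mazur's principle on cycles, CONDITIONAL on the announced Kim 2025
clause** (`hK25s`, flag `Kim2025-preprint`) — the N11 TAM-DEFECT₂(3) block: analytic rank `0`,
`ρ̄_{E,p^n}` onto for all `n`, conductor-level datum at level `Mℓ` with the period transfer, `#Ш_an` a
`p`-unit, `ord_p ∏c ≤ 2`, a split multiplicative `ℓ ∤ M`, `ℓ ≠ p`, with `p ∣ c_ℓ` and
(`ℓ ≢ 1 (mod p)` ∨ `#E(ℚ_ℓ)[p] ≠ p²`), the numeral `q₀`, Ihara's lemma BY NAME, and the typed target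
at `(W, p, ℓ, D.f)` ⟹ `BSD(E,p)`. [claim: Kim2025RefinedTNC, status: under-review]
[cite: Kim2025RefinedTNC, Thm. 1.1 ("BSD") (ANNOUNCED, OPEN binder)] [cite: RibetStein2001, Thm. 3.14]
[cite: Ribet1984ICM, Thm. 4.1] [cite: Kim2022StructureSelmer, Conj. 1.10 (PDF p. 8)] -/
theorem bsdp_of_oldOnCycles_of_tamagawa_le_two_of_shaAn_unit_of_kim2025_OPEN
    (hI : ribet1984_iharaLemma)
    (hK25s : Kim2025.thm11_kimShaLength_of_integralPeriod_OPEN)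
    (hCT : exists_casselsTate_pairing (K := ℚ))
    (hGZK : rank_eq_analyticRank_of_analyticRank_le_one) (hmod : hasEntireLFunction_rat)
    (hp3 : 3 ≤ p) (hr : W.analyticRank = 0) (htower : ∀ n : ℕ, W.HasSurjectiveModNGaloisRep (p ^ n : ℕ))
    {M : ℕ} [NeZero M] {ℓ : ℕ} [Fact ℓ.Prime] [NeZero (M * ℓ)]
    (D : ModularParametrizationData W (M * ℓ)) (hN : W.conductorNorm ℤ = M * ℓ)
    (hper : ∃ u : ℚ, ‖(u : ℚ_[p])‖ = 1 ∧ W.realPeriodRat = u * plusPeriod D.f)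
    {q' : ℚ} (hq' : shaAn W = (q' : ℂ)) (hv : padicValRat p q' = 0)
    (hc2 : padicValNat p W.tamagawaProduct ≤ 2)
    (hℓp : ℓ ≠ p) (hℓM : ¬ ℓ ∣ M) (hsplit : W.HasSplitMultiplicativeReductionAtPrime ℓ)
    (hcℓ : p ∣ (W.baseChange ℚ_[ℓ]).localTamagawaNumber ℤ_[ℓ])
    (hns : ¬ ℓ ≡ 1 [MOD p] ∨
      Nat.card {P : (W.baseChange ℚ_[ℓ]).toAffine.Point // p • P = 0} ≠ p ^ 2)
    {q₀ : ℕ} (hq₀ : q₀.Prime) (hq₀1 : q₀ ≡ 1 [MOD M * ℓ])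
    (haq₀ : ((W.LFunction q₀ : ℤ) : ZMod p) ≠ q₀ + 1)
    (hOC : MazurPrincipleOldOnCycles W p ℓ D.f) : BSDp W p :=
  bsdp_of_mazurPrinciple_of_tamagawa_le_two_of_shaAn_unit_of_kim2025_OPEN W p hK25s hCT hGZK hmod hp3
    hr htower D hN hper hq' hv hc2 hℓp (dvd_mul_left ℓ M)
    (fun h ↦ hℓM (Nat.dvd_of_mul_dvd_mul_right (Fact.out : ℓ.Prime).pos (by rwa [pow_two] at h)))
    hsplit hcℓ hns (mazurPrincipleLevelLowersAt_of_oldOnCycles hI hq₀ hq₀1 haq₀ hOC)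

end Summit.BirchSwinnertonDyer.Rank1Residual.X4

end
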